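import Summits.CriticalPhenomena.PercolationContinuityZ3.Theorems.Transplant.BoxProdZ2TubeLevels
import HarnessLib

/-!
# Levels of `X □ ℤ²` INSIDE A REGION `U`: the `U`-restricted graph `G'_U` (edges of `X □ ℤ²` with both endpoints in `U`) and the
# `U`-levels `B⟨j⟩ = U ∩ (W × Icc (lo - j) (hi + j))` — the graph structure in which the corridor chain of the lag-1 scheme runs
# (HOME/prim-bschramm-p2-g2/EDGE-CONTACTS.md §7: `U = E_i ∪ E^α_{v,x} ∪ H^β_{x,y}`, cross-section of a row = the fresh fibre range of that row)

builds on p205010 (kernel theorem, internal audit signed; external expert review pending) — nothing in this file uses p205010.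
Lane `prim-bschramm`, seat `prim-bschramm-p2` (Corridor-over-levels; instance-side but kit-independent); helper file
(`--supports stmt-CriticalPhenomena-4575`).

Why not the tube graph over a fixed window `π`: `tubeRestrict π W` kills the frozen `E_i`-edges outside `π × ℤ²` (the source (32) is lost) and
`IsSubbox (tubeGraph X π) W D` fails when `π` is smaller than the fresh fibre cross-section of a row (fibre edges leaving `π` carry weight `p`).
In `G'_U` with `U`-levels: fibre neighbours inside `U` stay in the row, so contacts are MACRO (planar) and `nest` holds; `IsSubbox G'_U (Wcor …) D` is
p2's `isSubbox_Wcor_graph` with trivial side conditions; the source is `lt_real_reachB_Wcor` unchanged.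
* `restrictGraph G U`, `restrictGraph_adj/le`, local finiteness, `degree_restrictGraph_le`;
* `uLevel U lo hi j`, `mem_uLevel_iff`, `uLevel_monotone`, **`uLevel_nest`**, `mem_outerBoundary_uLevel` (a contact is a planar outer-boundary
  point of the box with `x ∈ U`);
* `uLData`, `reachB_uLData`, **`lhyp_U`**, **`stepII_U`** (degree bound `Δ + 4`).
[cite: KozmaNitzan2024, §4 p. 15 (B⟨R⟩), Lemma 10 (p. 17), p. 18 (Step II)] [cite: GrimmettPercolation1999, §7.2]
-/

noncomputable section

open MeasureTheory ProbabilityTheory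
open scoped ENNReal

namespace Summit.CriticalPhenomena.PercolationContinuityZ3.Theorems

namespace Transplant

namespace BoxProdZ2

open Literature.Probability.Percolation Literature.Probability.LatticeModels SimpleGraph
open KNLevels

/-! ## §1 The restricted graph -/

section Restrict

variable {V : Type*} (G : SimpleGraph V)

/-- **The `U`-restricted graph**: the edges of `G` with both endpoints in `U` (same vertex type; vertices off `U` are isolated).
[cite: KozmaNitzan2024, §4 p. 17 (the induced graph on D)] -/
def restrictGraph (U : Finset V) : SimpleGraph V where
  Adj u v := G.Adj u v ∧ u ∈ U ∧ v ∈ U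
  symm := ⟨fun _ _ h => ⟨h.1.symm, h.2.2, h.2.1⟩⟩
  loopless := ⟨fun _ h => h.1.ne rfl⟩

/-- Adjacency in the restricted graph. [folklore] -/
theorem restrictGraph_adj {U : Finset V} {u v : V} : (restrictGraph G U).Adj u v ↔ G.Adj u v ∧ u ∈ U ∧ v ∈ U := Iff.rfl

/-- The restricted graph is a subgraph. [folklore] -/
theorem restrictGraph_le (U : Finset V) : restrictGraph G U ≤ G := fun _ _ h => h.1

/-- The restricted graph is locally finite. [folklore] -/
instance restrictGraph_locallyFinite [DecidableEq V] [G.LocallyFinite] (U : Finset V) : (restrictGraph G U).LocallyFinite := fun v =>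
  Fintype.ofFinset ((G.neighborFinset v).filter fun w => v ∈ U ∧ w ∈ U) fun w => by
    simp only [Finset.mem_filter, SimpleGraph.mem_neighborFinset, SimpleGraph.mem_neighborSet, restrictGraph_adj]

/-- Degrees in the restricted graph are at most those in `G`. [folklore] -/
theorem degree_restrictGraph_le [DecidableEq V] [G.LocallyFinite] (U : Finset V) {Δ : ℕ} (hΔ : ∀ x, G.degree x ≤ Δ) (v : V) :
    (restrictGraph G U).degree v ≤ Δ :=
  (SimpleGraph.degree_le_of_le (restrictGraph_le G U)).trans (hΔ v)

end Restrict

/-! ## §2 The `U`-levels of `X □ ℤ²` -/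

variable {W : Type*} [DecidableEq W] (X : SimpleGraph W) [X.LocallyFinite]

omit [DecidableEq W] [X.LocallyFinite] in
/-- **The `U`-level** `B⟨j⟩ = U ∩ (W × Icc (lo - j) (hi + j))`. [cite: KozmaNitzan2024, §4 p. 15 (B⟨R⟩)] -/
def uLevel (U : Finset (W × Site 2)) (lo hi : Site 2) (j : ℕ) : Finset (W × Site 2) :=
  U.filter fun v => v.2 ∈ Finset.Icc (lo - (j : Site 2)) (hi + (j : Site 2))

omit [DecidableEq W] [X.LocallyFinite] in
/-- Membership in a `U`-level. [folklore] -/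
theorem mem_uLevel_iff {U : Finset (W × Site 2)} {lo hi : Site 2} {j : ℕ} {v : W × Site 2} :
    v ∈ uLevel U lo hi j ↔ v ∈ U ∧ v.2 ∈ Finset.Icc (lo - (j : Site 2)) (hi + (j : Site 2)) := Finset.mem_filter

omit [DecidableEq W] [X.LocallyFinite] in
/-- `U`-levels lie in `U`. [folklore] -/
theorem uLevel_subset (U : Finset (W × Site 2)) (lo hi : Site 2) (j : ℕ) : uLevel U lo hi j ⊆ U := Finset.filter_subset _ _

omit [DecidableEq W] [X.LocallyFinite] in
/-- **Level axiom 1**: the `U`-levels increase. [folklore] -/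
theorem uLevel_monotone (U : Finset (W × Site 2)) (lo hi : Site 2) : Monotone (uLevel U lo hi) := by
  intro j j' h v hv
  rw [mem_uLevel_iff] at hv ⊢
  refine ⟨hv.1, Finset.Icc_subset_Icc (fun i => ?_) (fun i => ?_) hv.2⟩ <;>
    simp only [Pi.sub_apply, Pi.add_apply, Pi.natCast_apply] <;> omega

/-- **A contact of a `U`-level is MACRO**: an outer-boundary point (in `G'_U`) of `B⟨j⟩` lies in `U`, has the fibre of a level point and a
planar coordinate on the planar outer boundary of the box. [cite: KozmaNitzan2024, §4 p. 15 (∂_ev B)] -/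
theorem mem_outerBoundary_uLevel {U : Finset (W × Site 2)} {lo hi : Site 2} {j : ℕ} {x : W × Site 2}
    (hx : x ∈ outerBoundary (restrictGraph (X □ zdGraph 2) U) (uLevel U lo hi j)) :
    x ∈ U ∧ x.2 ∈ outerBoundary (zdGraph 2) (Finset.Icc (lo - (j : Site 2)) (hi + (j : Site 2))) ∧
      ∃ y ∈ uLevel U lo hi j, x.1 = y.1 ∧ (zdGraph 2).Adj x.2 y.2 := by
  rw [mem_outerBoundary_iff] at hx
  obtain ⟨hxn, y, hy, hxy⟩ := hx
  obtain ⟨hadj, hxU, -⟩ := (restrictGraph_adj _).1 hxy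
  have hy' := (mem_uLevel_iff).1 hy
  rcases SimpleGraph.boxProd_adj.1 hadj with ⟨-, h2⟩ | ⟨h1, h2⟩
  · -- a fibre edge inside `U` stays in the row: `x` would be a level point
    exact absurd ((mem_uLevel_iff).2 ⟨hxU, h2 ▸ hy'.2⟩) hxn
  · have hx2 : x.2 ∉ Finset.Icc (lo - (j : Site 2)) (hi + (j : Site 2)) := fun h => hxn ((mem_uLevel_iff).2 ⟨hxU, h⟩)
    exact ⟨hxU, mem_outerBoundary_iff.2 ⟨hx2, y.2, hy'.2, h1⟩, y, hy, h2, h1⟩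

/-- **Level axiom 2 in `G'_U`**: the outer boundary of `B⟨j⟩` lies in `B⟨j+1⟩`. [cite: KozmaNitzan2024, §4 p. 15 (∂_ev B ⊆ B⟨1⟩)] -/
theorem uLevel_nest (U : Finset (W × Site 2)) (lo hi : Site 2) (j : ℕ) :
    outerBoundary (restrictGraph (X □ zdGraph 2) U) (uLevel U lo hi j) ⊆ uLevel U lo hi (j + 1) := by
  intro x hx
  obtain ⟨hxU, hob, -⟩ := mem_outerBoundary_uLevel X hx
  rw [mem_uLevel_iff]
  refine ⟨hxU, ?_⟩
  have h := KozmaNitzan.mem_Icc_enlarge_one_of_mem_outerBoundary hob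
  refine Finset.Icc_subset_Icc (fun i => ?_) (fun i => ?_) h <;>
    simp only [Pi.sub_apply, Pi.add_apply, Pi.natCast_apply, Pi.one_apply] <;> push_cast <;> omega

/-! ## §3 The level data, the hypotheses of Lemma 10, Step II -/

omit [X.LocallyFinite] in
/-- **The `U`-level data** in `G'_U`. [cite: KozmaNitzan2024, §4 Lemma 10 (p. 17)] -/
def uLData (U : Finset (W × Site 2)) (lo hi : Site 2) (o : W × Site 2) (Sfin : Finset (W × Site 2)) :
    LData (restrictGraph (X □ zdGraph 2) U) :=
  ⟨uLevel U lo hi, o, Sfin⟩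

omit [DecidableEq W] [X.LocallyFinite] in
/-- The levels of `uLData`. [folklore] -/
@[simp] theorem uLData_X (U : Finset (W × Site 2)) (lo hi : Site 2) (o : W × Site 2) (Sfin : Finset (W × Site 2)) :
    (uLData X U lo hi o Sfin).X = uLevel U lo hi := rfl

omit [DecidableEq W] [X.LocallyFinite] in
/-- The source of `uLData`. [folklore] -/
@[simp] theorem uLData_o (U : Finset (W × Site 2)) (lo hi : Site 2) (o : W × Site 2) (Sfin : Finset (W × Site 2)) :
    (uLData X U lo hi o Sfin).o = o := rfl

omit [DecidableEq W] [X.LocallyFinite] in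
/-- The support of `uLData`. [folklore] -/
@[simp] theorem uLData_Sfin (U : Finset (W × Site 2)) (lo hi : Site 2) (o : W × Site 2) (Sfin : Finset (W × Site 2)) :
    (uLData X U lo hi o Sfin).Sfin = Sfin := rfl

omit [DecidableEq W] [X.LocallyFinite] in
/-- `{o ↔ B}` for the `U`-level data. [folklore] -/
theorem reachB_uLData (U : Finset (W × Site 2)) (lo hi : Site 2) (o : W × Site 2) (Sfin : Finset (W × Site 2)) :
    (uLData X U lo hi o Sfin).reachB = ⋃ b ∈ uLevel U lo hi 0, openConn o b := by
  rw [LData.reachB, uLData_X, uLData_o]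

/-- **The hypotheses of Lemma 10 for the `U`-levels in `G'_U`.** [cite: KozmaNitzan2024, §4 Lemma 10 (p. 17)] -/
theorem lhyp_U (U : Finset (W × Site 2)) (lo hi : Site 2) {o : W × Site 2} {Sfin D : Finset (W × Site 2)}
    {Wt : Sym2 (W × Site 2) → unitInterval} {p : unitInterval} {R : ℕ}
    (hsub : IsSubbox (restrictGraph (X □ zdGraph 2) U) Wt p D) (hfin : FinSupp Wt Sfin) (hDS : D ⊆ Sfin)
    (hencl : uLevel U lo hi (R + 1) ⊆ D) (ho : o ∉ D) (hoS : o ∈ Sfin) :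
    LHyp (uLData X U lo hi o Sfin) Wt p D R where
  mono := uLevel_monotone U lo hi
  nest := uLevel_nest X U lo hi
  sub := hsub
  fin := hfin
  DS := hDS
  encl := hencl
  o_not := ho
  o_mem := hoS

/-- **Kozma–Nitzan's Step II over the `U`-levels** (degrees `≤ Δ + 4`). [cite: KozmaNitzan2024, §4 p. 18 (Step II)] -/
theorem stepII_U [Countable W] {Δ : ℕ} (hΔ : ∀ w, X.degree w ≤ Δ)
    (U : Finset (W × Site 2)) (lo hi : Site 2) {o : W × Site 2} {Sfin D : Finset (W × Site 2)}
    {Wt : Sym2 (W × Site 2) → unitInterval} {p : unitInterval} {R : ℕ}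
    (hsub : IsSubbox (restrictGraph (X □ zdGraph 2) U) Wt p D) (hfin : FinSupp Wt Sfin) (hDS : D ⊆ Sfin)
    (hencl : uLevel U lo hi (R + 1) ⊆ D) (ho : o ∉ D) (hoS : o ∈ Sfin)
    (hp1 : (p : ℝ) < 1) {N j₀ j₁ : ℕ} (hj₁ : j₁ ≤ R) {δ : ℝ}
    (hJ : 1 / (1 - (p : ℝ)) ^ ((Δ + 4) * N) ≤ δ * ((Finset.Icc j₀ j₁).card : ℝ))
    (hreach : 1 - δ < (prodBernoulli Wt).real (⋃ b ∈ uLevel U lo hi 0, openConn o b)) :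
    ∃ j ∈ Finset.Icc j₀ j₁, 1 - 2 * δ < (prodBernoulli Wt).real {ω | N ≤ ((uLData X U lo hi o Sfin).Kont j ω).card} := by
  have hL := lhyp_U X U lo hi hsub hfin hDS hencl ho hoS
  rw [← reachB_uLData X U lo hi o Sfin] at hreach
  exact hL.stepII (degree_restrictGraph_le _ U (ProdKN.degree_prod_le X hΔ)) hp1 hj₁ hJ hreach

end BoxProdZ2

end Transplant

end Summit.CriticalPhenomena.PercolationContinuityZ3.Theorems

end
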